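import Summits.AtomisticToContinuum.BoseEinsteinCondensation.Theorems.BECConjugateDominationPuffFloorNoBindingOfStability
import Summits.AtomisticToContinuum.BoseEinsteinCondensation.Theorems.BECConjugateDominationPuffFloorPairMomentOfPairCount
import Literature.MathematicalPhysics.QuantumManyBody.PairCubeCounting

/-!
# Route `BECConjugateDomination`, crux `PuffFloor` (stmt-AtomisticToContinuum-11785),
# line `coupling-slope-pocket`, stub S7out: pairs closer than `R₀` are controlled by the energy
# plus the pairs closer than `r_in`

Supports (does not close) stmt-AtomisticToContinuum-11785. For EVERY measurable pair profile
`v ≥ 0`, every `0 < r_in` and `0 < R₀` there are `K ≥ 0` and `L₀ > 0` such that on every torus of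
side `L ≥ L₀`, for every particle number `N` and every periodic trial state `Ψ`,

  `E_Ψ #{i<j : |xᵢ - xⱼ|_per ≤ R₀} ≤ K · (⟨Ψ, H(v)Ψ⟩ + E_Ψ #{i<j : |xᵢ - xⱼ|_per ≤ r_in})`,

where the counts are the periodic interactions of the indicator profiles `1_{(-∞,R₀]}` and
`1_{(-∞,r_in]}`. This is J. O. Lee, J. Stat. Phys. 134 (2009), Thm. 7 (no binding from classical
stability) applied to the CORED comparison potential `v' = v + 1_{(-∞,r_in]}` (positive core of
height `1` and radius `r_in`) and the weight `W = 1_{(-∞,R₀]}` (measurable, vanishing beyond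
`R₀`): classical stability of `v' - t₁W` is the cube counting `pair_count_le`
(`#{≤ R₀} ≤ K₁ (#{< r_in} + N)`), the two-body floor and Lee's Lemma 9 on Neumann cubes are
`exists_le_neumannGroundStateEnergy_two` / `cube_domination`, the cell method is
`setLIntegral_sameCell_le_boxN`, the torus step `torus_domination_of_grid`; finally
`periodicEnergy v' Ψ = periodicEnergy v Ψ + E_Ψ #{≤ r_in}` by linearity of the periodisation in
the profile. The assembly copies `stub_noBindingOfStability` (same line, stub S2).

References: J. O. Lee, J. Stat. Phys. 134 (2009) 1–18 = arXiv:0803.0533, Thm. 7, Lemmas 9, 11;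
LSSY2005 Ch. 2; D. Ruelle, *Statistical Mechanics* (1969) §3.2.
-/

noncomputable section

namespace Summit.AtomisticToContinuum.BoseEinsteinCondensation.Theorems

open MeasureTheory Filter
open scoped ENNReal NNReal BigOperators
open Literature.MathematicalPhysics.QuantumManyBody.BoseGas

namespace PuffFloorPairCountDomination

/-- The `ℝ≥0∞` indicator of `(-∞, R]` is `ofReal` of the real `0/1` step. [folklore] -/
theorem indicator_Iic_eq (R : ℝ) :
    Set.indicator (Set.Iic R) (fun _ : ℝ => (1 : ℝ≥0∞)) =
      fun r => ENNReal.ofReal (if r ≤ R then (1 : ℝ) else 0) := by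
  funext r
  by_cases hr : r ≤ R
  · rw [Set.indicator_of_mem (show r ∈ Set.Iic R from hr), if_pos hr, ENNReal.ofReal_one]
  · rw [Set.indicator_of_notMem (show r ∉ Set.Iic R from hr), if_neg hr, ENNReal.ofReal_zero]

/-- The interaction of the indicator profile `1_{(-∞,R]}` is the number of pairs `i < j` at
distance `≤ R`. [folklore] -/
theorem interaction_indicator {n : ℕ} (R : ℝ) (X : Config n) :
    interaction (Set.indicator (Set.Iic R) (fun _ : ℝ => (1 : ℝ≥0∞))) X =
      ENNReal.ofReal (∑ i, ∑ j with i < j, if dist (X i) (X j) ≤ R then (1 : ℝ) else 0) := by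
  rw [indicator_Iic_eq]
  exact interaction_ofReal (fun r => if r ≤ R then (1 : ℝ) else 0)
    (fun r => by split_ifs <;> norm_num) X

/-- **Classical stability of `v + 1_{(-∞,r_in]} - t₁ 1_{(-∞,R₀]}`** with constant `1 · N`,
`t₁ = 1 / max K₁ 1`, from the cube counting `#{i<j : |xᵢ-xⱼ| ≤ R₀} ≤ K₁ (#{i<j : |xᵢ-xⱼ| < r_in} + N)`
(`pair_count_le`) and `#{< r_in} ≤ #{≤ r_in} ≤ ∑_{i<j} (v + 1_{(-∞,r_in]})`. [folklore] -/
theorem stability (v : ℝ → ℝ≥0∞) {rin : ℝ} (hrin : 0 < rin) (R₀ : ℝ) :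
    ∃ t₁ : ℝ, 0 < t₁ ∧ ∀ (n : ℕ) (X : Config n),
      ENNReal.ofReal t₁ * interaction (Set.indicator (Set.Iic R₀) (fun _ : ℝ => (1 : ℝ≥0∞))) X ≤
        interaction (fun r => v r + Set.indicator (Set.Iic rin) (fun _ : ℝ => (1 : ℝ≥0∞)) r) X +
          ENNReal.ofReal (1 * n) := by
  obtain ⟨K₁, _hK₁, hcount⟩ := pair_count_le rin R₀ hrin
  set K₂ := max K₁ 1 with hK₂_def
  have hK₂pos : 0 < K₂ := lt_max_of_lt_right one_pos
  have hK₁₂ : K₁ ≤ K₂ := le_max_left _ _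
  refine ⟨1 / K₂, by positivity, fun n X => ?_⟩
  set A := ∑ i, ∑ j with i < j, if dist (X i) (X j) ≤ R₀ then (1 : ℝ) else 0 with hA_def
  set B := ∑ i, ∑ j with i < j, if dist (X i) (X j) < rin then (1 : ℝ) else 0 with hB_def
  have hB0 : 0 ≤ B := Finset.sum_nonneg fun i _ => Finset.sum_nonneg fun j _ => by
    split_ifs <;> norm_num
  have h1 : A ≤ K₂ * (B + n) :=
    (hcount n X).trans (mul_le_mul_of_nonneg_right hK₁₂ (add_nonneg hB0 (Nat.cast_nonneg n)))
  have h2 : 1 / K₂ * A ≤ B + n := by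
    rw [one_div, inv_mul_le_iff₀ hK₂pos]
    exact h1
  have hIX : ENNReal.ofReal B ≤
      interaction (fun r => v r + Set.indicator (Set.Iic rin) (fun _ : ℝ => (1 : ℝ≥0∞)) r) X := by
    calc ENNReal.ofReal B
        ≤ ENNReal.ofReal (∑ i, ∑ j with i < j, if dist (X i) (X j) ≤ rin then (1 : ℝ) else 0) := by
          refine ENNReal.ofReal_le_ofReal
            (Finset.sum_le_sum fun i _ => Finset.sum_le_sum fun j _ => ?_)
          by_cases h : dist (X i) (X j) < rin
          · rw [if_pos h, if_pos h.le]
          · rw [if_neg h]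
            split_ifs <;> norm_num
      _ = interaction (Set.indicator (Set.Iic rin) (fun _ : ℝ => (1 : ℝ≥0∞))) X :=
          (interaction_indicator rin X).symm
      _ ≤ _ := by
          unfold interaction
          exact Finset.sum_le_sum fun i _ => Finset.sum_le_sum fun j _ => le_add_self
  calc ENNReal.ofReal (1 / K₂) * interaction (Set.indicator (Set.Iic R₀) (fun _ : ℝ => (1 : ℝ≥0∞))) X
      = ENNReal.ofReal (1 / K₂ * A) := by
        rw [interaction_indicator R₀ X, ENNReal.ofReal_mul (by positivity)]
    _ ≤ ENNReal.ofReal (B + n) := ENNReal.ofReal_le_ofReal h2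
    _ = ENNReal.ofReal B + ENNReal.ofReal (1 * n) := by
        rw [ENNReal.ofReal_add hB0 (Nat.cast_nonneg n), one_mul]
    _ ≤ _ := add_le_add hIX le_rfl

/-- **Linearity of the periodic energy in the profile**: `⟨Ψ, H(v + u)Ψ⟩ = ⟨Ψ, H(v)Ψ⟩ +
∫ (∑_{i<j} u^per)|Ψ|²` (additivity of the periodisation, `lintegral_add_left`). [folklore] -/
theorem periodicEnergy_add {v : ℝ → ℝ≥0∞} (hvm : Measurable v) (u : ℝ → ℝ≥0∞) {N : ℕ} {L : ℝ}
    (Ψ : PeriodicTrialState N L) :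
    periodicEnergy (fun r => v r + u r) Ψ =
      periodicEnergy v Ψ +
        ∫⁻ X in cellN N L, periodicInteraction u L X * (‖Ψ.ψ X‖₊ : ℝ≥0∞) ^ 2 := by
  unfold periodicEnergy
  have hmeas : Measurable fun X : Config N =>
      kineticDensity Ψ.ψ X + periodicInteraction v L X * (‖Ψ.ψ X‖₊ : ℝ≥0∞) ^ 2 :=
    (measurable_kineticDensity Ψ.contDiff).add
      ((measurable_periodicInteraction hvm L).mul (measurable_normSq Ψ.contDiff.continuous))
  rw [← lintegral_add_left hmeas]
  refine lintegral_congr fun X => ?_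
  rw [PuffFloorPairMomentOfPairCount.periodicInteraction_add, add_mul, add_assoc]

/-- **Lee's Theorem 7 for the cored comparison potential.** For measurable `v`, `0 < r_in`,
`0 < R₀`: there are `c > 0`, `L₀ > 0` with
`c ∫ (∑_{i<j} 1^per_{≤R₀})|Ψ|² ≤ 8 ⟨Ψ, H(v + 1_{(-∞,r_in]})Ψ⟩` for every periodic trial state on
every torus of side `L ≥ L₀` — core of `v'` of height `1`, radius `r_in`; `ℓ₁ = max (4R₀) (r_in/2)`,
`L₀ = 2ℓ₁`, `c = δ t₁`, `δ = min ½ (e/6)`. [cite: Lee2009, Thm. 7] -/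
theorem domination {v : ℝ → ℝ≥0∞} (hvm : Measurable v) {rin R₀ : ℝ} (hrin : 0 < rin)
    (hR₀ : 0 < R₀) :
    ∃ c L₀ : ℝ, 0 < c ∧ 0 < L₀ ∧ ∀ (N : ℕ) (L : ℝ), L₀ ≤ L → ∀ Ψ : PeriodicTrialState N L,
      ENNReal.ofReal c * (∫⁻ X in cellN N L,
          periodicInteraction (Set.indicator (Set.Iic R₀) (fun _ : ℝ => (1 : ℝ≥0∞))) L X *
            (‖Ψ.ψ X‖₊ : ℝ≥0∞) ^ 2)
        ≤ 8 * periodicEnergy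
            (fun r => v r + Set.indicator (Set.Iic rin) (fun _ : ℝ => (1 : ℝ≥0∞)) r) Ψ := by
  set W : ℝ → ℝ≥0∞ := Set.indicator (Set.Iic R₀) (fun _ : ℝ => (1 : ℝ≥0∞)) with hW_def
  set v' : ℝ → ℝ≥0∞ := fun r => v r + Set.indicator (Set.Iic rin) (fun _ : ℝ => (1 : ℝ≥0∞)) r
    with hv'_def
  have hWm : Measurable W := measurable_const.indicator measurableSet_Iic
  have hWR : ∀ r, R₀ < r → W r = 0 := fun r hr =>
    Set.indicator_of_notMem (show r ∉ Set.Iic R₀ from not_le.2 hr) _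
  have hv'm : Measurable v' := hvm.add (measurable_const.indicator measurableSet_Iic)
  -- the positive core of the cored potential
  have hcore : ∀ r, 0 ≤ r → r < rin → ENNReal.ofReal 1 ≤ v' r := fun r _ hr => by
    rw [ENNReal.ofReal_one]
    show (1 : ℝ≥0∞) ≤ v r + Set.indicator (Set.Iic rin) (fun _ : ℝ => (1 : ℝ≥0∞)) r
    rw [Set.indicator_of_mem (show r ∈ Set.Iic rin from hr.le)]
    exact le_add_self
  -- the mesh scale and the two-body floor
  set ℓ₁ := max (4 * R₀) (rin / 2) with hℓ₁_def
  have hℓ₁pos : 0 < ℓ₁ := lt_max_of_lt_left (by positivity)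
  have hℓ₁R : 4 * R₀ ≤ ℓ₁ := le_max_left _ _
  have hℓ₁r : rin / 2 ≤ ℓ₁ := le_max_right _ _
  obtain ⟨e, he, hfloor⟩ :=
    exists_le_neumannGroundStateEnergy_two (v := v') one_pos hrin hcore hℓ₁r
  -- classical stability with constant `1 · n`
  obtain ⟨t₁, ht₁, hstab⟩ := stability v hrin R₀
  set δ := min (1 / 2) (e / (6 * 1)) with hδ_def
  have hδ : 0 < δ := lt_min (by norm_num) (by positivity)
  refine ⟨δ * t₁, 2 * ℓ₁, by positivity, by positivity, fun N L hL Ψ => ?_⟩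
  -- the grid
  obtain ⟨M, ℓ, hM, hℓ1, hℓ2, hLℓ⟩ := NoBindingOfStability.exists_mesh hℓ₁pos hL
  have hℓpos : 0 < ℓ := hℓ₁pos.trans_le hℓ1
  have hRℓ : 4 * R₀ ≤ ℓ := hℓ₁R.trans hℓ1
  -- Lee's Lemma 9 on every Neumann cube of side `ℓ`
  have hbox : ∀ (n : ℕ) (φ : Config n → ℂ), ContDiff ℝ 1 φ →
      ENNReal.ofReal (δ * t₁) * ∫⁻ Y in boxN n ℓ, interaction W Y * (‖φ Y‖₊ : ℝ≥0∞) ^ 2 ≤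
        ∫⁻ Y in boxN n ℓ, kineticDensity φ Y + interaction v' Y * (‖φ Y‖₊ : ℝ≥0∞) ^ 2 :=
    fun n φ hφ => cube_domination hv'm hℓpos he one_pos (hfloor ℓ hℓ1 hℓ2) hstab n φ hφ
  -- the cell method, form version, on the big cube `Λ_L^N`
  have hgrid : ∀ Φ : PeriodicTrialState N L,
      ENNReal.ofReal (δ * t₁) * ∫⁻ X in boxN N L, (∑ i : Fin N, ∑ j : Fin N with i < j,
          if (∀ k : Fin 3, ⌊X i k / ℓ⌋ = ⌊X j k / ℓ⌋) then W (dist (X i) (X j)) else 0) *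
            (‖Φ.ψ X‖₊ : ℝ≥0∞) ^ 2 ≤
        ∫⁻ X in boxN N L, kineticDensity Φ.ψ X + interaction v' X * (‖Φ.ψ X‖₊ : ℝ≥0∞) ^ 2 := by
    intro Φ
    have h := setLIntegral_sameCell_le_boxN (N := N) hM hℓpos hv'm hWm Φ.contDiff hbox
    rwa [← hLℓ] at h
  -- the torus step
  exact torus_domination_of_grid hM hℓpos hLℓ hWm hWR hRℓ hgrid Ψ

end PuffFloorPairCountDomination

/-- **Stub S7out `stub_pairCountDomination` of the registered skeleton of line
`coupling-slope-pocket` (crux stmt-AtomisticToContinuum-11785), verbatim**: for every measurable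
pair profile `v`, `0 < r_in`, `0 < R₀` there are `K ≥ 0`, `L₀ > 0` such that for every `N`, every
torus side `L ≥ L₀` and every periodic trial state `Ψ`,
`E_Ψ #{i<j : |xᵢ-xⱼ|_per ≤ R₀} ≤ K (⟨Ψ,H(v)Ψ⟩ + E_Ψ #{i<j : |xᵢ-xⱼ|_per ≤ r_in})`. Proof: Lee's
Theorem 7 for the cored potential `v + 1_{(-∞,r_in]}` and the weight `1_{(-∞,R₀]}`
(`PuffFloorPairCountDomination.domination`), linearity of the energy in the profile
(`periodicEnergy_add`), and `K = 8/c`. Sources: J. O. Lee, J. Stat. Phys. 134 (2009),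
Thm. 7; LSSY2005 Ch. 2; Ruelle (1969) §3.2. -/
theorem stub_pairCountDomination :
    ∀ v : ℝ → ℝ≥0∞, Measurable v → ∀ rin R₀ : ℝ, 0 < rin → 0 < R₀ →
      ∃ K L₀ : ℝ, 0 ≤ K ∧ 0 < L₀ ∧ ∀ (N : ℕ) (L : ℝ), L₀ ≤ L → ∀ Ψ : PeriodicTrialState N L,
        (∫⁻ X in cellN N L,
            periodicInteraction (Set.indicator (Set.Iic R₀) (fun _ : ℝ => (1 : ℝ≥0∞))) L X *
              (‖Ψ.ψ X‖₊ : ℝ≥0∞) ^ 2)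
          ≤ ENNReal.ofReal K * (periodicEnergy v Ψ +
              ∫⁻ X in cellN N L,
                periodicInteraction (Set.indicator (Set.Iic rin) (fun _ : ℝ => (1 : ℝ≥0∞))) L X *
                  (‖Ψ.ψ X‖₊ : ℝ≥0∞) ^ 2) := by
  intro v hvm rin R₀ hrin hR₀
  obtain ⟨c, L₀, hc, hL₀, hdom⟩ := PuffFloorPairCountDomination.domination hvm hrin hR₀
  refine ⟨8 / c, L₀, by positivity, hL₀, fun N L hL Ψ => ?_⟩
  have h := hdom N L hL Ψ
  rw [PuffFloorPairCountDomination.periodicEnergy_add hvm] at h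
  set A := ∫⁻ X in cellN N L,
    periodicInteraction (Set.indicator (Set.Iic R₀) (fun _ : ℝ => (1 : ℝ≥0∞))) L X *
      (‖Ψ.ψ X‖₊ : ℝ≥0∞) ^ 2 with hA_def
  set E := periodicEnergy v Ψ +
    ∫⁻ X in cellN N L,
      periodicInteraction (Set.indicator (Set.Iic rin) (fun _ : ℝ => (1 : ℝ≥0∞))) L X *
        (‖Ψ.ψ X‖₊ : ℝ≥0∞) ^ 2 with hE_def
  have hc0 : ENNReal.ofReal c ≠ 0 := (ENNReal.ofReal_pos.2 hc).ne'
  calc A = (ENNReal.ofReal c)⁻¹ * (ENNReal.ofReal c * A) := by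
        rw [← mul_assoc, ENNReal.inv_mul_cancel hc0 ENNReal.ofReal_ne_top, one_mul]
    _ ≤ (ENNReal.ofReal c)⁻¹ * (8 * E) := by gcongr
    _ = ENNReal.ofReal (8 / c) * E := by
        rw [← mul_assoc, ENNReal.ofReal_div_of_pos hc, ENNReal.ofReal_ofNat, div_eq_mul_inv,
          mul_comm (8 : ℝ≥0∞)]

end Summit.AtomisticToContinuum.BoseEinsteinCondensation.Theorems

end
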